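import Literature.AlgebraicGeometry.ShimuraVarieties.UnitaryAuxiliaryComplexStructure
import Literature.AlgebraicGeometry.ModuliOfAbelianVarieties.RestrictionOfScalarsEigenrows
import HarnessLib

/-!
# Left `+i`-eigenrows of Deligne's `h_W(i)` over `ℂ` (the complexified eigen-census of `J_{β,Φ}(z)`)

Topic `AlgebraicGeometry/ShimuraVarieties`; namespace `Literature.AlgebraicGeometry.ShimuraVarieties.UnitaryCanonicalModel.Aux`
(sequel of ★ (g-b) `UnitaryAuxiliaryComplexStructure` §7 `embOf`, (E1)/(E2), and of ★ `RestrictionOfScalarsEigenrows`).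
THEOREMS ONLY.

`J_{β,Φ}(z) = P_ℝ · res_{1⊗b}(B_z) · Q_ℝ` with `B_z = diag(iPhi, iPhi·s_z) ∈ M₄(ℝ ⊗_ℚ M)` (★ `auxRep`, ★ `coe_blockGL`).  After base
change to `ℂ`, the left eigenrows of `res(B_z)` are read embedding by embedding (★ `vecMul_resMatrix_map`): a row
`c ⊗ r_σ = ((j,l) ↦ c_j σ(b_l))` is a left `+i`-eigenrow iff `c · σ̃(B_z) = i c`, where `σ̃(B_z)` is `diag(i, i·sComp σ)`
for `σ ∈ Φ` (E1) and `diag(-i, -i·conj(sComp σ̄))` for `σ ∉ Φ` (E2).  This file records the CENSUS of solutions `c`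
(`w = lift z = (z₀, z₁, 1)`, `q = w̄ᵀJw ≠ 0`):

* §1 reflection rows: `d·reflJ(w) = d` iff-direction `d·w = 0` (`vecMul_reflJ_of_dotProduct_eq_zero`), and
  `(w̄ᵀJ)·reflJ(w) = -(w̄ᵀJ)` (`star_vecMul_J_vecMul_reflJ`), with their transports to the frame `T·reflJ·T⁻¹` and conjugates;
* §2 the `4 × 4` eigen-equations: `(c₀ | c')·diag(i, iS) = i(c₀ | c')` when `c'S = c'`; `(0 | c')·diag(-i, -iS') = i(0 | c')`
  when `c'S' = -c'`;
* §3 THE ROWS, indexed by `Φ × (Fin 1 ⊕ Fin 3)` (cardinal `4·#Φ = 2[M:ℚ] = g`) and AFFINE-LINEAR in `u ∈ ℂ²` (`w = (u₀, u₁, 1)`):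
  for `ρ ∈ Φ`: the `W₀`-row `e₀ ⊗ r_ρ`; for `ρ∘j ≠ τ` the three rows `e_k ⊗ r_ρ`; for `ρ∘j = τ` the two rows
  `(0 | d^k(u)·T⁻¹) ⊗ r_ρ` (`d⁰ = (1,0,-u₀)`, `d¹ = (0,1,-u₁)`) and the CONJUGATE-EMBEDDING row `(0 | (wᵀJ)·T̄⁻¹) ⊗ r_ρ̄`
  (`eigenrow_apply`, `eigenrow_vecMul_resMatrix` = each is a left `+i`-eigenrow of `res(B_z)_ℂ` at `u = z`);
* §4 the rows are linearly independent for EVERY `u` (`linearIndependent_eigenrow`; ★ `linearIndependent_tensorRows` +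
  ★ `linearIndependent_embeddingRows`).

Consumer: the period chart `z ↦ Z(γ J_{β,Φ}(z) γ⁻¹) = Δ·R₂(z)⁻¹·R₁(z)` (★ `siegelOfJ_eq_of_leftEigenrows`) of the unitary-to-Siegel
embedding, whose holomorphy in `z` is thereby reduced to that of a rational function (sequel `UnitaryAuxiliaryPeriodMap`).

## References
* [Deligne1979ShimuraVarieties] P. Deligne, *Variétés de Shimura*, Prop. 2.3.10 (PDF p. 32 of Milne's translation).
* [Deligne1971TravauxShimura] P. Deligne, *Travaux de Shimura*, 1.14–1.15, 4.9.
* [Milne2005ShimuraVarieties] J. S. Milne, *Introduction to Shimura varieties*, §8 p. 81.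
-/

set_option autoImplicit false

noncomputable section

open Matrix NumberField
open scoped TensorProduct ComplexConjugate Classical

namespace Literature.AlgebraicGeometry.ShimuraVarieties

namespace UnitaryCanonicalModel

namespace Aux

open Literature.AlgebraicGeometry.ModuliOfAbelianVarieties
open Literature.AlgebraicGeometry.Motives (CMType)
open Literature.Geometry.ComplexHyperbolic

/-! ### §1. Reflection rows -/

section ReflectionRows

variable {d w : Fin 3 → ℂ}

/-- **Rows `J`-orthogonal to `w` are fixed by the reflection `reflJ w` (acting on the right)**: `d·w = 0 ⇒ d·r_w = d`
(`r_w = 1 - 2q⁻¹ w (w̄ᵀJ)`, and `d·(w (w̄ᵀJ)) = (d·w)(w̄ᵀJ)`). [cite: Deligne1979ShimuraVarieties, Prop. 2.3.10 (PDF p. 32)] -/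
theorem vecMul_reflJ_of_dotProduct_eq_zero (h : d ⬝ᵥ w = 0) : d ᵥ* reflJ w = d := by
  rw [reflJ, projJ, Matrix.vecMul_sub, Matrix.vecMul_one, Matrix.vecMul_smul, Matrix.vecMul_smul,
    Matrix.vecMul_vecMulVec, h, zero_smul, smul_zero, smul_zero, sub_zero]

/-- `(w̄ᵀJ)·w = q(w)`. [cite: Jacobowitz1990, Ch. 2 §1 (p. 40)] -/
theorem star_vecMul_J_dotProduct (w : Fin 3 → ℂ) : (star w ᵥ* BallModel.J) ⬝ᵥ w = formJ w := by
  rw [formJ, Matrix.dotProduct_mulVec]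

/-- **The row `w̄ᵀJ` is a `(-1)`-eigenrow of `reflJ w`** (`q(w) ≠ 0`): `(w̄ᵀJ)·r_w = -(w̄ᵀJ)`.
[cite: Deligne1979ShimuraVarieties, Prop. 2.3.10 (PDF p. 32)] -/
theorem star_vecMul_J_vecMul_reflJ (hw : formJ w ≠ 0) :
    (star w ᵥ* BallModel.J) ᵥ* reflJ w = -(star w ᵥ* BallModel.J) := by
  rw [reflJ, projJ, Matrix.vecMul_sub, Matrix.vecMul_one, Matrix.vecMul_smul, Matrix.vecMul_smul,
    Matrix.vecMul_vecMulVec, star_vecMul_J_dotProduct, smul_smul, smul_smul, mul_assoc, inv_mul_cancel₀ hw, mul_one,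
    two_smul]
  abel

/-- `J` has real entries: `conj` fixes it entrywise. [cite: Jacobowitz1990, Ch. 2 §1 (p. 40)] -/
theorem J_map_conj : BallModel.J.map (starRingEnd ℂ) = BallModel.J := by
  rw [BallModel.J, Matrix.diagonal_map (map_zero _)]
  congr 1
  funext i
  fin_cases i <;> simp

/-- `conj ∘ (w̄ᵀJ) = wᵀJ` (entrywise conjugate of the row `w̄ᵀJ`). [cite: Jacobowitz1990, Ch. 2 §1 (p. 40)] -/
theorem conj_star_vecMul_J (w : Fin 3 → ℂ) :
    (starRingEnd ℂ) ∘ (star w ᵥ* BallModel.J) = w ᵥ* BallModel.J := by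
  funext i
  rw [Function.comp_apply, RingHom.map_vecMul, J_map_conj]
  have hsw : (starRingEnd ℂ) ∘ star w = w := by
    funext k
    simp
  rw [hsw]

/-- **Conjugated form**: the row `wᵀJ` is a `(-1)`-eigenrow of the entrywise conjugate `conj(reflJ w)` (`q(w) ≠ 0`).
[cite: Deligne1979ShimuraVarieties, Prop. 2.3.10 (PDF p. 32)] -/
theorem vecMul_J_vecMul_reflJ_map_conj (hw : formJ w ≠ 0) :
    (w ᵥ* BallModel.J) ᵥ* (reflJ w).map (starRingEnd ℂ) = -(w ᵥ* BallModel.J) := by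
  have h := star_vecMul_J_vecMul_reflJ hw
  have h2 : ∀ i, (starRingEnd ℂ) (((star w ᵥ* BallModel.J) ᵥ* reflJ w) i) =
      (((starRingEnd ℂ) ∘ (star w ᵥ* BallModel.J)) ᵥ* (reflJ w).map (starRingEnd ℂ)) i :=
    fun i ↦ RingHom.map_vecMul _ _ _ i
  funext i
  have h3 := h2 i
  rw [conj_star_vecMul_J] at h3
  rw [← h3, h, Pi.neg_apply, map_neg, Pi.neg_apply]
  congr 1
  exact (congrFun (conj_star_vecMul_J w) i)

variable (T : GL (Fin 3) ℂ)

/-- **Transport to the frame**: if `d·r_w = d` then `(d·T⁻¹)·(T r_w T⁻¹) = d·T⁻¹`.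
[cite: Deligne1979ShimuraVarieties, Prop. 2.3.10 (PDF p. 32)] -/
theorem vecMul_reflFrame_of_vecMul_reflJ (h : d ᵥ* reflJ w = d) :
    (d ᵥ* ((T⁻¹ : GL (Fin 3) ℂ) : Matrix (Fin 3) (Fin 3) ℂ)) ᵥ* reflFrame T w =
      d ᵥ* ((T⁻¹ : GL (Fin 3) ℂ) : Matrix (Fin 3) (Fin 3) ℂ) := by
  have hTi : ((T⁻¹ : GL (Fin 3) ℂ) : Matrix (Fin 3) (Fin 3) ℂ) * (T : Matrix (Fin 3) (Fin 3) ℂ) = 1 := by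
    rw [← Units.val_mul, inv_mul_cancel, Units.val_one]
  rw [reflFrame, Matrix.vecMul_vecMul, ← Matrix.mul_assoc, ← Matrix.mul_assoc, hTi, Matrix.one_mul,
    ← Matrix.vecMul_vecMul, h]

/-- **Transport to the conjugate frame**: if `e·conj(r_w) = -e` then `(e·T̄⁻¹)·conj(T r_w T⁻¹) = -(e·T̄⁻¹)`.
[cite: Deligne1979ShimuraVarieties, Prop. 2.3.10 (PDF p. 32)] -/
theorem vecMul_reflFrame_map_conj_of_vecMul {e : Fin 3 → ℂ} (h : e ᵥ* (reflJ w).map (starRingEnd ℂ) = -e) :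
    (e ᵥ* (((T⁻¹ : GL (Fin 3) ℂ) : Matrix (Fin 3) (Fin 3) ℂ).map (starRingEnd ℂ))) ᵥ*
        (reflFrame T w).map (starRingEnd ℂ) =
      -(e ᵥ* (((T⁻¹ : GL (Fin 3) ℂ) : Matrix (Fin 3) (Fin 3) ℂ).map (starRingEnd ℂ))) := by
  have hTi : (((T⁻¹ : GL (Fin 3) ℂ) : Matrix (Fin 3) (Fin 3) ℂ).map (starRingEnd ℂ)) *
      (T : Matrix (Fin 3) (Fin 3) ℂ).map (starRingEnd ℂ) = 1 := by
    rw [← Matrix.map_mul, ← Units.val_mul, inv_mul_cancel, Units.val_one, Matrix.map_one _ (map_zero _) (map_one _)]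
  rw [reflFrame, Matrix.map_mul, Matrix.map_mul, Matrix.vecMul_vecMul, ← Matrix.mul_assoc, ← Matrix.mul_assoc, hTi,
    Matrix.one_mul, ← Matrix.vecMul_vecMul, h, Matrix.neg_vecMul]

end ReflectionRows

/-! ### §2. The `4 × 4` eigen-equations -/

section BlockEigen

/-- `(c₀ | c')·diag(i, i·S) = i·(c₀ | c')` when `c'·S = c'`. [cite: Deligne1979ShimuraVarieties, Prop. 2.3.10 (PDF p. 32)] -/
theorem vecMul_fromBlocks_I_of_vecMul_eq {S : Matrix (Fin 3) (Fin 3) ℂ} {c₀ : Fin 1 → ℂ} {c' : Fin 3 → ℂ}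
    (h : c' ᵥ* S = c') :
    Sum.elim c₀ c' ᵥ* Matrix.fromBlocks (Complex.I • (1 : Matrix (Fin 1) (Fin 1) ℂ)) 0 0 (Complex.I • S) =
      Complex.I • Sum.elim c₀ c' := by
  rw [Matrix.vecMul_fromBlocks, Sum.elim_comp_inl, Sum.elim_comp_inr, Matrix.vecMul_zero, Matrix.vecMul_zero,
    add_zero, zero_add, Matrix.vecMul_smul, Matrix.vecMul_smul, Matrix.vecMul_one, h]
  funext i
  rcases i with i | i <;> simp

/-- `(0 | c')·diag(-i, -i·S') = i·(0 | c')` when `c'·S' = -c'`. [cite: Deligne1979ShimuraVarieties, Prop. 2.3.10 (PDF p. 32)] -/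
theorem vecMul_fromBlocks_neg_I_of_vecMul_eq_neg {S' : Matrix (Fin 3) (Fin 3) ℂ} {c' : Fin 3 → ℂ}
    (h : c' ᵥ* S' = -c') :
    Sum.elim (0 : Fin 1 → ℂ) c' ᵥ*
        Matrix.fromBlocks ((-Complex.I) • (1 : Matrix (Fin 1) (Fin 1) ℂ)) 0 0 ((-Complex.I) • S') =
      Complex.I • Sum.elim (0 : Fin 1 → ℂ) c' := by
  have h2 : c' ᵥ* ((-Complex.I) • S') = Complex.I • c' := by
    rw [Matrix.vecMul_smul, h, smul_neg, neg_smul, neg_neg]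
  rw [Matrix.vecMul_fromBlocks, Sum.elim_comp_inl, Sum.elim_comp_inr, Matrix.zero_vecMul, Matrix.zero_vecMul,
    Matrix.vecMul_zero, zero_add, h2]
  funext i
  rcases i with i | i <;> simp

end BlockEigen

/-! ### §3. The census of eigenrows, indexed by `Φ × (Fin 1 ⊕ Fin 3)` and affine in `u ∈ ℂ²` -/

section Census

variable {L : Type} [Field L] (M : Type) [Field M] [NumberField M] (Φ : CMType M) (j : L →+* M) (τ : L →+* ℂ)
  (T : GL (Fin 3) ℂ)

/-- The homogeneous coordinates `(u₀, u₁, 1)` of `u ∈ ℂ²` (`= BallModel.lift z` for `u = z` in the ball).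
[cite: Deligne1979ShimuraVarieties, Prop. 2.3.10 (PDF p. 32)] -/
def liftVec (u : Fin 2 → ℂ) : Fin 3 → ℂ := ![u 0, u 1, 1]

/-- `liftVec z = lift z` on the ball. [cite: Deligne1979ShimuraVarieties, Prop. 2.3.10 (PDF p. 32)] -/
@[simp] theorem liftVec_coe (z : BallModel.Ball) : liftVec z.1 = BallModel.lift z := rfl

/-- The rows `d⁰(u) = (1, 0, -u₀)`, `d¹(u) = (0, 1, -u₁)` — a basis of the rows `d` with `d·(u₀, u₁, 1) = 0`, AFFINE in `u`.
[cite: Deligne1979ShimuraVarieties, Prop. 2.3.10 (PDF p. 32)] -/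
def dRow (k : Fin 2) (u : Fin 2 → ℂ) : Fin 3 → ℂ :=
  Pi.single (Fin.castSucc k) 1 - (u k) • Pi.single (2 : Fin 3) 1

/-- `d^k(u) · (u₀, u₁, 1) = 0`. [cite: Deligne1979ShimuraVarieties, Prop. 2.3.10 (PDF p. 32)] -/
theorem dRow_dotProduct_liftVec (k : Fin 2) (u : Fin 2 → ℂ) : dRow k u ⬝ᵥ liftVec u = 0 := by
  fin_cases k <;> simp [dRow, liftVec, dotProduct, Fin.sum_univ_three]

/-- **The tensor row `c ⊗ r_σ = ((i, l) ↦ c_i · σ(b_l))`** over the `ℚ`-basis `b = ratBasis M` of `M`.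
[cite: Deligne1971TravauxShimura, 4.9 p. 148] -/
def eigRow (σ : M →+* ℂ) (c : Fin 1 ⊕ Fin 3 → ℂ) : (Fin 1 ⊕ Fin 3) × Fin (Module.finrank ℚ M) → ℂ :=
  fun p => c p.1 * σ (ratBasis M p.2)

/-- `eigRow` is linear in the coefficient row. [cite: Deligne1971TravauxShimura, 4.9 p. 148] -/
theorem eigRow_add (σ : M →+* ℂ) (c c' : Fin 1 ⊕ Fin 3 → ℂ) :
    eigRow M σ (c + c') = eigRow M σ c + eigRow M σ c' := by
  funext p; simp [eigRow, add_mul]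

/-- `eigRow` is homogeneous in the coefficient row. [cite: Deligne1971TravauxShimura, 4.9 p. 148] -/
theorem eigRow_smul (σ : M →+* ℂ) (a : ℂ) (c : Fin 1 ⊕ Fin 3 → ℂ) :
    eigRow M σ (a • c) = a • eigRow M σ c := by
  funext p; simp [eigRow, mul_assoc]

/-- **The embedding attached to the index `(ρ, k)`**: `ρ` itself, except for `(ρ, inr 2)` with `ρ∘j = τ`, which carries
the CONJUGATE embedding `ρ̄ ∉ Φ`. [cite: Deligne1979ShimuraVarieties, Prop. 2.3.10 (PDF p. 32)] -/
def censusEmb (ρ : Φ.1) (k : Fin 1 ⊕ Fin 3) : M →+* ℂ :=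
  if ρ.1.comp j = τ ∧ k = Sum.inr 2 then ComplexEmbedding.conjugate ρ.1 else ρ.1

/-- **The coefficient row attached to the index `(ρ, k)` at the parameter `u ∈ ℂ²`**: for `ρ∘j ≠ τ` the standard rows
`e_k`; for `ρ∘j = τ`: `e_{inl 0}`, `(0 | d⁰(u)·T⁻¹)`, `(0 | d¹(u)·T⁻¹)`, `(0 | (wᵀJ)·T̄⁻¹)` (`w = (u₀, u₁, 1)`).
[cite: Deligne1979ShimuraVarieties, Prop. 2.3.10 (PDF p. 32)] -/
def censusCoeff (ρ : Φ.1) (k : Fin 1 ⊕ Fin 3) (u : Fin 2 → ℂ) : Fin 1 ⊕ Fin 3 → ℂ :=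
  if ρ.1.comp j = τ then
    match k with
    | Sum.inl _ => Pi.single (Sum.inl 0) 1
    | Sum.inr k' =>
      if hk : (k' : ℕ) < 2 then
        Sum.elim 0 (dRow ⟨k', hk⟩ u ᵥ* ((T⁻¹ : GL (Fin 3) ℂ) : Matrix (Fin 3) (Fin 3) ℂ))
      else
        Sum.elim 0 ((liftVec u ᵥ* BallModel.J) ᵥ* (((T⁻¹ : GL (Fin 3) ℂ) : Matrix (Fin 3) (Fin 3) ℂ).map (starRingEnd ℂ)))
  else Pi.single k 1

/-- **The census row** `(ρ, k) ↦ censusCoeff ⊗ r_{censusEmb}`. [cite: Deligne1979ShimuraVarieties, Prop. 2.3.10 (PDF p. 32)] -/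
def censusRow (x : Φ.1 × (Fin 1 ⊕ Fin 3)) (u : Fin 2 → ℂ) : (Fin 1 ⊕ Fin 3) × Fin (Module.finrank ℚ M) → ℂ :=
  eigRow M (censusEmb M Φ j τ x.1 x.2) (censusCoeff M Φ j τ T x.1 x.2 u)

/-! #### The census rows are eigenrows of the `σ`-images of `diag(iPhi, iPhi·s_z)` -/

/-- **Each census coefficient row is a left `+i`-eigenrow of the corresponding `σ`-image of `B_z = diag(iPhi, iPhi·s_z)`**
(`u = z` a ball point): E1/E2 of ★ `UnitaryAuxiliaryComplexStructure` §7 with §1–§2 above.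
[cite: Deligne1979ShimuraVarieties, Prop. 2.3.10 (PDF p. 32)] -/
theorem censusCoeff_vecMul_blockGL_map (x : Φ.1 × (Fin 1 ⊕ Fin 3)) (z : BallModel.Ball) :
    censusCoeff M Φ j τ T x.1 x.2 z.1 ᵥ*
        (((blockGL (ℝ ⊗[ℚ] M) (iPhi M Φ, sPhi M j Φ τ T z) : GL (Fin 1 ⊕ Fin 3) (ℝ ⊗[ℚ] M)) :
          Matrix (Fin 1 ⊕ Fin 3) (Fin 1 ⊕ Fin 3) (ℝ ⊗[ℚ] M)).map (embOf M (censusEmb M Φ j τ x.1 x.2))) =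
      Complex.I • censusCoeff M Φ j τ T x.1 x.2 z.1 := by
  obtain ⟨ρ, k⟩ := x
  by_cases hρ : ρ.1.comp j = τ
  · -- over `τ`
    rcases k with k | k'
    · -- the `W₀`-row `e_{inl 0}`
      have hemb : censusEmb M Φ j τ ρ (Sum.inl k) = ρ.1 := by
        simp [censusEmb]
      have hc : censusCoeff M Φ j τ T ρ (Sum.inl k) z.1 = Pi.single (Sum.inl 0) 1 := by
        simp [censusCoeff, hρ]
      rw [hemb, hc, coe_blockGL_iPhi_sPhi_map_embOf_of_mem M Φ j τ T ρ.2 z]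
      have h1 : (Pi.single (Sum.inl 0) 1 : Fin 1 ⊕ Fin 3 → ℂ) = Sum.elim (Pi.single 0 1) 0 := by
        funext i; rcases i with i | i
        · fin_cases i; simp
        · simp
      rw [h1]
      exact vecMul_fromBlocks_I_of_vecMul_eq (by rw [Matrix.zero_vecMul])
    · by_cases hk : (k' : ℕ) < 2
      · -- the two rows `(0 | d^k·T⁻¹)`
        have hemb : censusEmb M Φ j τ ρ (Sum.inr k') = ρ.1 := by
          have : ¬ (ρ.1.comp j = τ ∧ (Sum.inr k' : Fin 1 ⊕ Fin 3) = Sum.inr 2) := by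
            rintro ⟨-, h⟩
            have h2 : k' = 2 := Sum.inr_injective h
            rw [h2] at hk
            exact absurd hk (by decide)
          simp only [censusEmb]
          rw [if_neg this]
        have hc : censusCoeff M Φ j τ T ρ (Sum.inr k') z.1 =
            Sum.elim (0 : Fin 1 → ℂ) (dRow ⟨k', hk⟩ z.1 ᵥ* ((T⁻¹ : GL (Fin 3) ℂ) : Matrix (Fin 3) (Fin 3) ℂ)) := by
          simp [censusCoeff, hρ, hk]
        rw [hemb, hc, coe_blockGL_iPhi_sPhi_map_embOf_of_mem M Φ j τ T ρ.2 z, sComp_of_eq _ hρ]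
        refine vecMul_fromBlocks_I_of_vecMul_eq (vecMul_reflFrame_of_vecMul_reflJ T ?_)
        exact vecMul_reflJ_of_dotProduct_eq_zero (by rw [← liftVec_coe]; exact dRow_dotProduct_liftVec _ _)
      · -- the conjugate-embedding row `(0 | (wᵀJ)·T̄⁻¹)`
        have hk2 : k' = 2 := by
          fin_cases k' <;> simp_all
        subst hk2
        have hemb : censusEmb M Φ j τ ρ (Sum.inr 2) = ComplexEmbedding.conjugate ρ.1 := by
          simp [censusEmb, hρ]
        have hc : censusCoeff M Φ j τ T ρ (Sum.inr 2) z.1 =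
            Sum.elim (0 : Fin 1 → ℂ) ((liftVec z.1 ᵥ* BallModel.J) ᵥ*
              (((T⁻¹ : GL (Fin 3) ℂ) : Matrix (Fin 3) (Fin 3) ℂ).map (starRingEnd ℂ))) := by
          simp only [censusCoeff]
          rw [if_pos hρ]
          simp
        have hnot : ComplexEmbedding.conjugate ρ.1 ∉ Φ.1 := (Φ.2 ρ.1).1 ρ.2
        have hinv : ComplexEmbedding.conjugate (ComplexEmbedding.conjugate ρ.1) = ρ.1 :=
          ComplexEmbedding.involutive_conjugate M ρ.1
        have hcc : ComplexEmbedding.conjugate (ComplexEmbedding.conjugate ρ.1) ∈ Φ.1 := by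
          rw [hinv]; exact ρ.2
        rw [hemb, hc, coe_blockGL_iPhi_sPhi_map_embOf_of_not_mem M Φ j τ T hnot hcc z]
        have hρ' : (⟨ComplexEmbedding.conjugate (ComplexEmbedding.conjugate ρ.1), hcc⟩ : Φ.1) = ρ :=
          Subtype.ext hinv
        rw [hρ', sComp_of_eq _ hρ]
        refine vecMul_fromBlocks_neg_I_of_vecMul_eq_neg (vecMul_reflFrame_map_conj_of_vecMul T ?_)
        rw [liftVec_coe]
        exact vecMul_J_vecMul_reflJ_map_conj (formJ_lift_ne_zero z)
  · -- off `τ`: `sComp = 1`, every standard row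
    have hemb : censusEmb M Φ j τ ρ k = ρ.1 := by
      simp [censusEmb, hρ]
    have hc : censusCoeff M Φ j τ T ρ k z.1 = Pi.single k 1 := by
      simp [censusCoeff, hρ]
    rw [hemb, hc, coe_blockGL_iPhi_sPhi_map_embOf_of_mem M Φ j τ T ρ.2 z, sComp_of_ne _ hρ]
    have h1 : (Pi.single k 1 : Fin 1 ⊕ Fin 3 → ℂ) =
        Sum.elim (fun i => (Pi.single k (1 : ℂ) : Fin 1 ⊕ Fin 3 → ℂ) (Sum.inl i))
          (fun i => (Pi.single k (1 : ℂ) : Fin 1 ⊕ Fin 3 → ℂ) (Sum.inr i)) := by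
      funext i; rcases i with i | i <;> rfl
    rw [h1]
    exact vecMul_fromBlocks_I_of_vecMul_eq (by rw [Matrix.vecMul_one])

/-! #### … hence left `+i`-eigenrows of the complexified restriction of scalars `res(B_z)_ℂ` -/

/-- `embOf σ` on the `ℝ`-basis `1 ⊗ b_l` of `ℝ ⊗_ℚ M`: `σ(b_l)`. [cite: Shimura1998, §6.2 Thm. 4, p. 45] -/
theorem embOf_basis (σ : M →+* ℂ) (l : Fin (Module.finrank ℚ M)) :
    embOf M σ (Algebra.TensorProduct.basis ℝ (ratBasis M) l) = σ (ratBasis M l) := by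
  rw [Algebra.TensorProduct.basis_apply, embOf_tmul, Complex.ofReal_one, one_mul]

/-- `eigRow σ c` is the row `c ⊗ r_{embOf σ}` of ★ `vecMul_resMatrix_map` for the basis `1 ⊗ b`.
[cite: Deligne1971TravauxShimura, 4.9 p. 148] -/
theorem eigRow_eq (σ : M →+* ℂ) (c : Fin 1 ⊕ Fin 3 → ℂ) :
    eigRow M σ c = fun p => c p.1 * embOf M σ (Algebra.TensorProduct.basis ℝ (ratBasis M) p.2) := by
  funext p; rw [eigRow, embOf_basis]

/-- **`eigRow σ c` is a left `μ`-eigenrow of `res(B)_ℂ` whenever `c·σ̃(B) = μ·c`.** [cite: Deligne1971TravauxShimura, 4.9 p. 148] -/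
theorem eigRow_vecMul_resMatrix_of_vecMul_eq_smul (σ : M →+* ℂ) {c : Fin 1 ⊕ Fin 3 → ℂ} {μ : ℂ}
    (B : Matrix (Fin 1 ⊕ Fin 3) (Fin 1 ⊕ Fin 3) (ℝ ⊗[ℚ] M)) (hc : c ᵥ* B.map (embOf M σ) = μ • c) :
    eigRow M σ c ᵥ* (resMatrix (Algebra.TensorProduct.basis ℝ (ratBasis M)) B).map (algebraMap ℝ ℂ) =
      μ • eigRow M σ c := by
  rw [eigRow_eq]
  exact vecMul_resMatrix_map_of_vecMul_eq_smul _ (embOf M σ) B hc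

/-- The converse: an `eigRow σ c` which is a left `μ`-eigenrow of `res(B)_ℂ` comes from `c·σ̃(B) = μ·c` (some `σ(b_l) ≠ 0`,
indeed `σ(b_l) ≠ 0` for every `l` since `b_l ≠ 0`). [cite: Deligne1971TravauxShimura, 4.9 p. 148] -/
theorem vecMul_map_eq_smul_of_eigRow_vecMul_resMatrix (σ : M →+* ℂ) {c : Fin 1 ⊕ Fin 3 → ℂ} {μ : ℂ}
    (B : Matrix (Fin 1 ⊕ Fin 3) (Fin 1 ⊕ Fin 3) (ℝ ⊗[ℚ] M))
    (h : eigRow M σ c ᵥ* (resMatrix (Algebra.TensorProduct.basis ℝ (ratBasis M)) B).map (algebraMap ℝ ℂ) =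
      μ • eigRow M σ c) :
    c ᵥ* B.map (embOf M σ) = μ • c := by
  haveI : Nonempty (Fin (Module.finrank ℚ M)) := ⟨⟨0, Module.finrank_pos⟩⟩
  obtain ⟨l⟩ := (inferInstance : Nonempty (Fin (Module.finrank ℚ M)))
  have hl : embOf M σ (Algebra.TensorProduct.basis ℝ (ratBasis M) l) ≠ 0 := by
    rw [embOf_basis]
    exact (map_ne_zero σ).2 ((ratBasis M).ne_zero l)
  rw [eigRow_eq] at h
  exact vecMul_map_eq_smul_of_vecMul_resMatrix_map _ (embOf M σ) B hl h

/-- **Every census row is a left `+i`-eigenrow of `res(B_z)_ℂ`** (`u = z` in the ball).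
[cite: Deligne1979ShimuraVarieties, Prop. 2.3.10 (PDF p. 32)] -/
theorem censusRow_vecMul_resMatrix (x : Φ.1 × (Fin 1 ⊕ Fin 3)) (z : BallModel.Ball) :
    censusRow M Φ j τ T x z.1 ᵥ*
        (resMatrix (Algebra.TensorProduct.basis ℝ (ratBasis M))
          (((blockGL (ℝ ⊗[ℚ] M) (iPhi M Φ, sPhi M j Φ τ T z) : GL (Fin 1 ⊕ Fin 3) (ℝ ⊗[ℚ] M)) :
            Matrix (Fin 1 ⊕ Fin 3) (Fin 1 ⊕ Fin 3) (ℝ ⊗[ℚ] M)))).map (algebraMap ℝ ℂ) =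
      Complex.I • censusRow M Φ j τ T x z.1 :=
  eigRow_vecMul_resMatrix_of_vecMul_eq_smul M _ _ (censusCoeff_vecMul_blockGL_map M Φ j τ T x z)

/-! #### The rows are affine in `u` -/

/-- The `u₀`-slope of the coefficient row of index `(ρ, k)`. [cite: Deligne1979ShimuraVarieties, Prop. 2.3.10 (PDF p. 32)] -/
def censusSlope (a : Fin 2) (ρ : Φ.1) (k : Fin 1 ⊕ Fin 3) : Fin 1 ⊕ Fin 3 → ℂ :=
  if ρ.1.comp j = τ then
    match k with
    | Sum.inl _ => 0
    | Sum.inr k' =>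
      if (k' : ℕ) = (a : ℕ) then
        Sum.elim 0 (-(Pi.single (2 : Fin 3) (1 : ℂ) ᵥ* ((T⁻¹ : GL (Fin 3) ℂ) : Matrix (Fin 3) (Fin 3) ℂ)))
      else if (k' : ℕ) = 2 then
        Sum.elim 0 ((Pi.single (Fin.castSucc a) (1 : ℂ) ᵥ* BallModel.J) ᵥ*
          (((T⁻¹ : GL (Fin 3) ℂ) : Matrix (Fin 3) (Fin 3) ℂ).map (starRingEnd ℂ)))
      else 0
  else 0

/-- `liftVec` is affine: `liftVec u = liftVec 0 + u₀ e₀ + u₁ e₁`. [cite: Deligne1979ShimuraVarieties, Prop. 2.3.10 (PDF p. 32)] -/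
theorem liftVec_eq (u : Fin 2 → ℂ) :
    liftVec u = liftVec 0 + (u 0) • Pi.single (Fin.castSucc 0) 1 + (u 1) • Pi.single (Fin.castSucc 1) 1 := by
  funext i
  simp only [Pi.add_apply, Pi.smul_apply, Pi.single_apply, smul_eq_mul]
  fin_cases i <;> simp [liftVec]

omit [NumberField M] in
/-- **The coefficient rows are affine in `u`**: `c_x(u) = c_x(0) + u₀·a_x + u₁·b_x`.
[cite: Deligne1979ShimuraVarieties, Prop. 2.3.10 (PDF p. 32)] -/
theorem censusCoeff_eq_affine (ρ : Φ.1) (k : Fin 1 ⊕ Fin 3) (u : Fin 2 → ℂ) :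
    censusCoeff M Φ j τ T ρ k u = censusCoeff M Φ j τ T ρ k 0 + (u 0) • censusSlope M Φ j τ T 0 ρ k +
      (u 1) • censusSlope M Φ j τ T 1 ρ k := by
  by_cases hρ : ρ.1.comp j = τ
  · rcases k with k | k'
    · simp [censusCoeff, censusSlope, hρ]
    · -- the three `inr` rows over `τ`
      have hd : ∀ (k'' : Fin 2) (v : Fin 2 → ℂ), dRow k'' v ᵥ* ((T⁻¹ : GL (Fin 3) ℂ) : Matrix (Fin 3) (Fin 3) ℂ) =
          Pi.single (Fin.castSucc k'') (1 : ℂ) ᵥ* ((T⁻¹ : GL (Fin 3) ℂ) : Matrix (Fin 3) (Fin 3) ℂ) +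
            (v k'') • (-(Pi.single (2 : Fin 3) (1 : ℂ) ᵥ* ((T⁻¹ : GL (Fin 3) ℂ) : Matrix (Fin 3) (Fin 3) ℂ))) := by
        intro k'' v
        rw [dRow, Matrix.sub_vecMul, Matrix.smul_vecMul, smul_neg, sub_eq_add_neg]
      have hl : liftVec u ᵥ* BallModel.J = liftVec 0 ᵥ* BallModel.J +
          (u 0) • (Pi.single (Fin.castSucc 0) (1 : ℂ) ᵥ* BallModel.J) +
          (u 1) • (Pi.single (Fin.castSucc 1) (1 : ℂ) ᵥ* BallModel.J) := by
        rw [liftVec_eq u, Matrix.add_vecMul, Matrix.add_vecMul, Matrix.smul_vecMul, Matrix.smul_vecMul]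
      fin_cases k'
      · -- `k' = 0`: `(0 | d⁰(u)·T⁻¹)`
        show censusCoeff M Φ j τ T ρ (Sum.inr 0) u =
          censusCoeff M Φ j τ T ρ (Sum.inr 0) 0 + (u 0) • censusSlope M Φ j τ T 0 ρ (Sum.inr 0) +
            (u 1) • censusSlope M Φ j τ T 1 ρ (Sum.inr 0)
        have e1 : censusCoeff M Φ j τ T ρ (Sum.inr 0) u =
            Sum.elim (0 : Fin 1 → ℂ) (dRow 0 u ᵥ* ((T⁻¹ : GL (Fin 3) ℂ) : Matrix (Fin 3) (Fin 3) ℂ)) := by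
          simp [censusCoeff, hρ]
        have e2 : censusCoeff M Φ j τ T ρ (Sum.inr 0) 0 =
            Sum.elim (0 : Fin 1 → ℂ) (dRow 0 0 ᵥ* ((T⁻¹ : GL (Fin 3) ℂ) : Matrix (Fin 3) (Fin 3) ℂ)) := by
          simp [censusCoeff, hρ]
        have e3 : censusSlope M Φ j τ T 0 ρ (Sum.inr 0) =
            Sum.elim (0 : Fin 1 → ℂ) (-(Pi.single (2 : Fin 3) (1 : ℂ) ᵥ* ((T⁻¹ : GL (Fin 3) ℂ) : Matrix (Fin 3) (Fin 3) ℂ))) := by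
          simp [censusSlope, hρ]
        have e4 : censusSlope M Φ j τ T 1 ρ (Sum.inr 0) = 0 := by
          simp [censusSlope, hρ]
        rw [e1, e2, e3, e4, smul_zero, add_zero, hd 0 u, hd 0 0]
        funext i; rcases i with i | i <;> simp
      · -- `k' = 1`
        show censusCoeff M Φ j τ T ρ (Sum.inr 1) u =
          censusCoeff M Φ j τ T ρ (Sum.inr 1) 0 + (u 0) • censusSlope M Φ j τ T 0 ρ (Sum.inr 1) +
            (u 1) • censusSlope M Φ j τ T 1 ρ (Sum.inr 1)
        have e1 : censusCoeff M Φ j τ T ρ (Sum.inr 1) u =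
            Sum.elim (0 : Fin 1 → ℂ) (dRow 1 u ᵥ* ((T⁻¹ : GL (Fin 3) ℂ) : Matrix (Fin 3) (Fin 3) ℂ)) := by
          simp [censusCoeff, hρ]
        have e2 : censusCoeff M Φ j τ T ρ (Sum.inr 1) 0 =
            Sum.elim (0 : Fin 1 → ℂ) (dRow 1 0 ᵥ* ((T⁻¹ : GL (Fin 3) ℂ) : Matrix (Fin 3) (Fin 3) ℂ)) := by
          simp [censusCoeff, hρ]
        have e3 : censusSlope M Φ j τ T 0 ρ (Sum.inr 1) = 0 := by
          simp [censusSlope, hρ]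
        have e4 : censusSlope M Φ j τ T 1 ρ (Sum.inr 1) =
            Sum.elim (0 : Fin 1 → ℂ) (-(Pi.single (2 : Fin 3) (1 : ℂ) ᵥ* ((T⁻¹ : GL (Fin 3) ℂ) : Matrix (Fin 3) (Fin 3) ℂ))) := by
          simp [censusSlope, hρ]
        rw [e1, e2, e3, e4, smul_zero, add_zero, hd 1 u, hd 1 0]
        funext i; rcases i with i | i <;> simp
      · -- `k' = 2`: `(0 | (wᵀJ)·T̄⁻¹)`
        show censusCoeff M Φ j τ T ρ (Sum.inr 2) u =
          censusCoeff M Φ j τ T ρ (Sum.inr 2) 0 + (u 0) • censusSlope M Φ j τ T 0 ρ (Sum.inr 2) +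
            (u 1) • censusSlope M Φ j τ T 1 ρ (Sum.inr 2)
        have e1 : ∀ v : Fin 2 → ℂ, censusCoeff M Φ j τ T ρ (Sum.inr 2) v =
            Sum.elim (0 : Fin 1 → ℂ) ((liftVec v ᵥ* BallModel.J) ᵥ*
              (((T⁻¹ : GL (Fin 3) ℂ) : Matrix (Fin 3) (Fin 3) ℂ).map (starRingEnd ℂ))) := by
          intro v
          simp only [censusCoeff]
          rw [if_pos hρ]
          simp
        have e3 : ∀ a : Fin 2, censusSlope M Φ j τ T a ρ (Sum.inr 2) =
            Sum.elim (0 : Fin 1 → ℂ) ((Pi.single (Fin.castSucc a) (1 : ℂ) ᵥ* BallModel.J) ᵥ*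
              (((T⁻¹ : GL (Fin 3) ℂ) : Matrix (Fin 3) (Fin 3) ℂ).map (starRingEnd ℂ))) := by
          intro a
          simp only [censusSlope]
          rw [if_pos hρ]
          fin_cases a <;> simp
        rw [e1 u, e1 0, e3 0, e3 1, hl, Matrix.add_vecMul, Matrix.add_vecMul, Matrix.smul_vecMul,
          Matrix.smul_vecMul]
        funext i; rcases i with i | i <;> simp
  · simp [censusCoeff, censusSlope, hρ]

/-- **The census rows are affine in `u`**: `row_x(u) = row_x(0) + u₀·A_x + u₁·B_x` with
`A_x = eigRow (censusEmb x) (censusSlope 0 x)` etc. [cite: Deligne1979ShimuraVarieties, Prop. 2.3.10 (PDF p. 32)] -/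
theorem censusRow_eq_affine (x : Φ.1 × (Fin 1 ⊕ Fin 3)) (u : Fin 2 → ℂ) :
    censusRow M Φ j τ T x u = censusRow M Φ j τ T x 0 +
      (u 0) • eigRow M (censusEmb M Φ j τ x.1 x.2) (censusSlope M Φ j τ T 0 x.1 x.2) +
      (u 1) • eigRow M (censusEmb M Φ j τ x.1 x.2) (censusSlope M Φ j τ T 1 x.1 x.2) := by
  rw [censusRow, censusRow, censusCoeff_eq_affine M Φ j τ T x.1 x.2 u, eigRow_add, eigRow_add, eigRow_smul, eigRow_smul]

/-! ### §4. Linear independence of the census rows (for every `u`) -/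

omit [NumberField M] in
/-- Two indices with the same attached embedding have the same `Φ`-component and the same «conjugate» status.
[cite: Deligne1979ShimuraVarieties, Prop. 2.3.10 (PDF p. 32)] -/
theorem eq_of_censusEmb_eq {ρ ρ' : Φ.1} {k k' : Fin 1 ⊕ Fin 3}
    (h : censusEmb M Φ j τ ρ' k' = censusEmb M Φ j τ ρ k) :
    ρ' = ρ ∧ ((ρ.1.comp j = τ ∧ k = Sum.inr 2) ↔ (ρ'.1.comp j = τ ∧ k' = Sum.inr 2)) := by
  unfold censusEmb at h
  by_cases h1 : ρ'.1.comp j = τ ∧ k' = Sum.inr 2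
  · by_cases h2 : ρ.1.comp j = τ ∧ k = Sum.inr 2
    · rw [if_pos h1, if_pos h2] at h
      have : ρ'.1 = ρ.1 := (ComplexEmbedding.involutive_conjugate M).injective h
      exact ⟨Subtype.ext this, ⟨fun _ => h1, fun _ => h2⟩⟩
    · rw [if_pos h1, if_neg h2] at h
      exact absurd (h ▸ ρ.2) ((Φ.2 ρ'.1).1 ρ'.2)
  · by_cases h2 : ρ.1.comp j = τ ∧ k = Sum.inr 2
    · rw [if_neg h1, if_pos h2] at h
      exact absurd (h.symm ▸ ρ'.2) ((Φ.2 ρ.1).1 ρ.2)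
    · rw [if_neg h1, if_neg h2] at h
      exact ⟨Subtype.ext h, ⟨fun h' => absurd h' h2, fun h' => absurd h' h1⟩⟩

/-- **The dual functionals of the census** (index `(ρ, k)`): evaluation at `k` off `τ`; over `τ`, evaluation at `inl 0`,
`v ↦ ((v|_{inr})·T)_k` for `k = inr 0, inr 1`, and `v ↦ -((v|_{inr})·T̄)_2` for `k = inr 2`.
[cite: Deligne1979ShimuraVarieties, Prop. 2.3.10 (PDF p. 32)] -/
def censusDual (ρ : Φ.1) (k : Fin 1 ⊕ Fin 3) : (Fin 1 ⊕ Fin 3 → ℂ) →ₗ[ℂ] ℂ :=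
  if ρ.1.comp j = τ then
    match k with
    | Sum.inl _ => LinearMap.proj (Sum.inl 0)
    | Sum.inr k' =>
      if (k' : ℕ) < 2 then
        LinearMap.proj k' ∘ₗ Matrix.vecMulLinear (T : Matrix (Fin 3) (Fin 3) ℂ) ∘ₗ LinearMap.funLeft ℂ ℂ Sum.inr
      else
        -(LinearMap.proj (2 : Fin 3) ∘ₗ Matrix.vecMulLinear ((T : Matrix (Fin 3) (Fin 3) ℂ).map (starRingEnd ℂ)) ∘ₗ
          LinearMap.funLeft ℂ ℂ Sum.inr)
  else LinearMap.proj k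

omit [NumberField M] in
/-- `(d·T⁻¹)·T = d`. [folklore] -/
private theorem vecMul_inv_vecMul (d : Fin 3 → ℂ) :
    (d ᵥ* ((T⁻¹ : GL (Fin 3) ℂ) : Matrix (Fin 3) (Fin 3) ℂ)) ᵥ* (T : Matrix (Fin 3) (Fin 3) ℂ) = d := by
  rw [Matrix.vecMul_vecMul, ← Units.val_mul, inv_mul_cancel, Units.val_one, Matrix.vecMul_one]

omit [NumberField M] in
/-- `(e·T̄⁻¹)·T̄ = e`. [folklore] -/
private theorem vecMul_inv_conj_vecMul (e : Fin 3 → ℂ) :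
    (e ᵥ* (((T⁻¹ : GL (Fin 3) ℂ) : Matrix (Fin 3) (Fin 3) ℂ).map (starRingEnd ℂ))) ᵥ*
        (T : Matrix (Fin 3) (Fin 3) ℂ).map (starRingEnd ℂ) = e := by
  rw [Matrix.vecMul_vecMul, ← Matrix.map_mul, ← Units.val_mul, inv_mul_cancel, Units.val_one,
    Matrix.map_one _ (map_zero _) (map_one _), Matrix.vecMul_one]

/-- `funLeft inr g = g ∘ inr` as functions. [folklore] -/
private theorem funLeft_inr_eq (g : Fin 1 ⊕ Fin 3 → ℂ) : LinearMap.funLeft ℂ ℂ Sum.inr g = g ∘ Sum.inr := rfl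

/-- The `inr`-part of `e_{inl 0}` vanishes. [folklore] -/
private theorem single_inl_comp_inr :
    (Pi.single (Sum.inl 0) (1 : ℂ) : Fin 1 ⊕ Fin 3 → ℂ) ∘ Sum.inr = 0 := by
  funext i
  simp

omit [NumberField M] in
/-- **Biorthogonality**: within a fiber of `censusEmb`, `Λ_{x₀}(c_x(u)) = δ_{x x₀}`.
[cite: Deligne1979ShimuraVarieties, Prop. 2.3.10 (PDF p. 32)] -/
theorem censusDual_censusCoeff (x₀ x : Φ.1 × (Fin 1 ⊕ Fin 3)) (u : Fin 2 → ℂ)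
    (h : censusEmb M Φ j τ x.1 x.2 = censusEmb M Φ j τ x₀.1 x₀.2) :
    censusDual M Φ j τ T x₀.1 x₀.2 (censusCoeff M Φ j τ T x.1 x.2 u) = if x = x₀ then 1 else 0 := by
  obtain ⟨ρ, k⟩ := x₀
  obtain ⟨ρ', k'⟩ := x
  dsimp only at h ⊢
  obtain ⟨hρρ, hiff⟩ := eq_of_censusEmb_eq M Φ j τ h
  subst ρ'
  by_cases hρ : ρ.1.comp j = τ
  · -- over `τ`
    have hTi := vecMul_inv_vecMul T
    have hTic := vecMul_inv_conj_vecMul T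
    rcases k with k | k₀ <;> rcases k' with k' | k₀'
    · -- both `inl`
      have hk : k = 0 := Subsingleton.elim _ _
      have hk' : k' = 0 := Subsingleton.elim _ _
      subst hk; subst hk'
      simp [censusDual, censusCoeff, hρ]
    · -- x₀ = inl, x = inr k₀'
      have hk : k = 0 := Subsingleton.elim _ _
      subst hk
      have hne : ((ρ, Sum.inr k₀') : Φ.1 × (Fin 1 ⊕ Fin 3)) ≠ (ρ, Sum.inl 0) := by simp
      rw [if_neg hne]
      by_cases hk₀' : (k₀' : ℕ) < 2
      · simp [censusDual, censusCoeff, hρ, hk₀']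
      · simp [censusDual, censusCoeff, hρ, hk₀']
    · -- x₀ = inr k₀, x = inl
      have hk' : k' = 0 := Subsingleton.elim _ _
      subst hk'
      have hne : ((ρ, Sum.inl 0) : Φ.1 × (Fin 1 ⊕ Fin 3)) ≠ (ρ, Sum.inr k₀) := by simp
      rw [if_neg hne]
      by_cases hk₀ : (k₀ : ℕ) < 2
      · simp only [censusDual, censusCoeff, hρ, hk₀, if_true, LinearMap.coe_comp, Function.comp_apply,
          funLeft_inr_eq, single_inl_comp_inr, Matrix.vecMulLinear_apply, Matrix.zero_vecMul, LinearMap.coe_proj,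
          Function.eval, Pi.zero_apply]
      · have hd : censusDual M Φ j τ T ρ (Sum.inr k₀) =
            -(LinearMap.proj (2 : Fin 3) ∘ₗ Matrix.vecMulLinear ((T : Matrix (Fin 3) (Fin 3) ℂ).map (starRingEnd ℂ)) ∘ₗ
              LinearMap.funLeft ℂ ℂ Sum.inr) := by
          simp [censusDual, hρ, hk₀]
        have hc : censusCoeff M Φ j τ T ρ (Sum.inl 0) u = Pi.single (Sum.inl 0) 1 := by
          simp [censusCoeff, hρ]
        rw [hd, hc]
        simp only [LinearMap.neg_apply, LinearMap.coe_comp, Function.comp_apply, funLeft_inr_eq, single_inl_comp_inr,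
          Matrix.vecMulLinear_apply, Matrix.zero_vecMul, LinearMap.coe_proj, Function.eval, Pi.zero_apply, neg_zero]
    · -- both `inr`
      by_cases hk₀ : (k₀ : ℕ) < 2
      · -- `x₀` is one of the two `d`-rows; then `x` is not the conjugate row either
        have hk₀' : (k₀' : ℕ) < 2 := by
          by_contra hc
          have h2 : k₀' = 2 := by fin_cases k₀' <;> simp_all
          have := (hiff.2 ⟨hρ, by rw [h2]⟩).2
          have h3 : k₀ = 2 := Sum.inr_injective this
          rw [h3] at hk₀; exact absurd hk₀ (by decide)
        have hv : ((Sum.elim (0 : Fin 1 → ℂ) (dRow ⟨k₀', hk₀'⟩ u ᵥ* ((T⁻¹ : GL (Fin 3) ℂ) : Matrix (Fin 3) (Fin 3) ℂ))) ∘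
            Sum.inr) ᵥ* (T : Matrix (Fin 3) (Fin 3) ℂ) = dRow ⟨k₀', hk₀'⟩ u := by
          rw [show ((Sum.elim (0 : Fin 1 → ℂ) (dRow ⟨k₀', hk₀'⟩ u ᵥ* ((T⁻¹ : GL (Fin 3) ℂ) : Matrix (Fin 3) (Fin 3) ℂ))) ∘
            Sum.inr) = dRow ⟨k₀', hk₀'⟩ u ᵥ* ((T⁻¹ : GL (Fin 3) ℂ) : Matrix (Fin 3) (Fin 3) ℂ) from rfl, hTi]
        simp only [censusDual, censusCoeff, hρ, if_true, hk₀, hk₀', dif_pos, LinearMap.coe_comp, Function.comp_apply,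
          funLeft_inr_eq, Matrix.vecMulLinear_apply, LinearMap.coe_proj, Function.eval, hv]
        fin_cases k₀ <;> fin_cases k₀' <;> simp_all [dRow]
      · have h2 : k₀ = 2 := by fin_cases k₀ <;> simp_all
        subst h2
        have := (hiff.1 ⟨hρ, rfl⟩).2
        have h3 : k₀' = 2 := Sum.inr_injective this
        subst h3
        have hv : ((Sum.elim (0 : Fin 1 → ℂ) ((liftVec u ᵥ* BallModel.J) ᵥ*
            (((T⁻¹ : GL (Fin 3) ℂ) : Matrix (Fin 3) (Fin 3) ℂ).map (starRingEnd ℂ)))) ∘ Sum.inr) ᵥ*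
            (T : Matrix (Fin 3) (Fin 3) ℂ).map (starRingEnd ℂ) = liftVec u ᵥ* BallModel.J := by
          rw [show ((Sum.elim (0 : Fin 1 → ℂ) ((liftVec u ᵥ* BallModel.J) ᵥ*
            (((T⁻¹ : GL (Fin 3) ℂ) : Matrix (Fin 3) (Fin 3) ℂ).map (starRingEnd ℂ)))) ∘ Sum.inr) =
            (liftVec u ᵥ* BallModel.J) ᵥ* (((T⁻¹ : GL (Fin 3) ℂ) : Matrix (Fin 3) (Fin 3) ℂ).map (starRingEnd ℂ))
            from rfl, hTic]
        have hd : censusDual M Φ j τ T ρ (Sum.inr 2) =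
            -(LinearMap.proj (2 : Fin 3) ∘ₗ Matrix.vecMulLinear ((T : Matrix (Fin 3) (Fin 3) ℂ).map (starRingEnd ℂ)) ∘ₗ
              LinearMap.funLeft ℂ ℂ Sum.inr) := by
          simp [censusDual, hρ]
        have hc : censusCoeff M Φ j τ T ρ (Sum.inr 2) u = Sum.elim (0 : Fin 1 → ℂ) ((liftVec u ᵥ* BallModel.J) ᵥ*
            (((T⁻¹ : GL (Fin 3) ℂ) : Matrix (Fin 3) (Fin 3) ℂ).map (starRingEnd ℂ))) := by
          simp only [censusCoeff]
          rw [if_pos hρ]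
          simp
        rw [hd, hc]
        simp only [if_true, LinearMap.neg_apply, LinearMap.coe_comp, Function.comp_apply, funLeft_inr_eq,
          Matrix.vecMulLinear_apply, LinearMap.coe_proj, Function.eval, hv]
        simp [liftVec, BallModel.J, Matrix.vecMul_diagonal]
  · -- off `τ`: standard rows and evaluations
    by_cases hkk : k' = k
    · subst hkk; simp [censusDual, censusCoeff, hρ]
    · have hne : ((ρ, k') : Φ.1 × (Fin 1 ⊕ Fin 3)) ≠ (ρ, k) := by simpa using hkk
      rw [if_neg hne]
      simp [censusDual, censusCoeff, hρ, Ne.symm hkk]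

/-- **The census rows are linearly independent, for every parameter `u ∈ ℂ²`.**  Group a vanishing combination by the
attached embedding (★ `linearIndependent_embeddingRows`: the rows `r_σ = (σ(b_l))_l` are independent), then apply the dual
functionals `censusDual` inside each fiber. [cite: Deligne1979ShimuraVarieties, Prop. 2.3.10 (PDF p. 32)] -/
theorem linearIndependent_censusRow (u : Fin 2 → ℂ) :
    LinearIndependent ℂ (fun x : Φ.1 × (Fin 1 ⊕ Fin 3) => censusRow M Φ j τ T x u) := by
  classical
  rw [Fintype.linearIndependent_iff]
  intro a ha x₀
  -- Step 1: inside each fiber of `censusEmb` the coefficient rows combine to zero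
  have hfib : ∀ σ : M →+* ℂ,
      ∑ x ∈ Finset.univ.filter (fun x : Φ.1 × (Fin 1 ⊕ Fin 3) => censusEmb M Φ j τ x.1 x.2 = σ),
        a x • censusCoeff M Φ j τ T x.1 x.2 u = 0 := by
    intro σ
    funext i
    have hr := Fintype.linearIndependent_iff.1 (linearIndependent_embeddingRows M (ratBasis M))
      (fun σ' => ∑ x ∈ Finset.univ.filter (fun x : Φ.1 × (Fin 1 ⊕ Fin 3) => censusEmb M Φ j τ x.1 x.2 = σ'),
        a x * censusCoeff M Φ j τ T x.1 x.2 u i) ?_ σ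
    · simpa only [Finset.sum_apply, Pi.smul_apply, smul_eq_mul, Pi.zero_apply] using hr
    · funext l
      have h := congrFun ha (i, l)
      simp only [Finset.sum_apply, Pi.smul_apply, smul_eq_mul, Pi.zero_apply, censusRow, eigRow] at h
      simp only [Finset.sum_apply, Pi.smul_apply, smul_eq_mul, Pi.zero_apply]
      rw [← h, ← Finset.sum_fiberwise Finset.univ (fun x : Φ.1 × (Fin 1 ⊕ Fin 3) => censusEmb M Φ j τ x.1 x.2)]
      refine Finset.sum_congr rfl fun σ' _ => ?_
      rw [Finset.sum_mul]
      refine Finset.sum_congr rfl fun x hx => ?_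
      rw [(Finset.mem_filter.1 hx).2, mul_assoc]
  -- Step 2: apply the dual functional of `x₀` inside its own fiber
  have h2 := congrArg (censusDual M Φ j τ T x₀.1 x₀.2) (hfib (censusEmb M Φ j τ x₀.1 x₀.2))
  rw [map_sum, map_zero] at h2
  have h3 : ∑ x ∈ Finset.univ.filter
      (fun x : Φ.1 × (Fin 1 ⊕ Fin 3) => censusEmb M Φ j τ x.1 x.2 = censusEmb M Φ j τ x₀.1 x₀.2),
      a x * (if x = x₀ then (1 : ℂ) else 0) = 0 := by
    refine Eq.trans (Finset.sum_congr rfl fun x hx => ?_) h2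
    rw [map_smul, smul_eq_mul, censusDual_censusCoeff M Φ j τ T x₀ x u (Finset.mem_filter.1 hx).2]
  have hx₀ : x₀ ∈ Finset.univ.filter
      (fun x : Φ.1 × (Fin 1 ⊕ Fin 3) => censusEmb M Φ j τ x.1 x.2 = censusEmb M Φ j τ x₀.1 x₀.2) :=
    Finset.mem_filter.2 ⟨Finset.mem_univ _, rfl⟩
  simp only [mul_ite, mul_one, mul_zero] at h3
  rw [Finset.sum_ite_eq' _ x₀, if_pos hx₀] at h3
  exact h3

end Census

end Aux

end UnitaryCanonicalModel

end Literature.AlgebraicGeometry.ShimuraVarieties
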